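import Summits.AtomisticToContinuum.HydrodynamicLimit.Theorems.TwoClocksTransferEntropyClockTailRateDefs
import Summits.AtomisticToContinuum.HydrodynamicLimit.Theorems.TwoClocksTransferEntropyClockExplicitKineticFamily
import Summits.AtomisticToContinuum.HydrodynamicLimit.Theorems.TwoClocksTransferEntropyClockTailRateWindowClause
import HarnessLib

/-!
# Line `tail-rate` of crux stmt-AtomisticToContinuum-16625 `TwoClocks.TransferEntropyClock`: the 3-child split glue and the restated clock (support file)

With the line's two provable stubs LANDED — S_E `TransferEntropyClockExplicitKineticFamily.stub_explicitKineticFamily : KCWUSharpPlus →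
KineticLDExplicitFamily` (p143300) and S_W′ `TransferEntropyClockTailRateWindowClause.stub_tailRateWindowClause : TailRateWindowClause` (the
D-shape one-window entropy ledger re-plumbed at the TAIL level: quantitative re-orthogonalised heat-flux cut-off, explicit kinetic instance with
tilt law `κ/(C_g K)`, cubic channel paid by the Gaussian tail alone) — the conditional closing `TransferEntropyClockTailRate.transferEntropyClock_of_tailRateNodes`
(p143292) specialises to the glue of the THREE-CHILD SPLIT of the crux:

* `transferEntropyClock_of_tailRateChildren : KCWUSharpPlus → LocalClampedTransferWindowLDFamily → UGibbsSRBRigidity.GaussianTails →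
  TwoClocks.TransferEntropyClock` — the `--glue-by` theorem: the macroscopic clock from (1) the pointwise kinetic-window LD rung with NUMERIC tilt
  threshold (`KCWUSharpPlus`, byte-identical with crux 16659's registered open stub), (2) the local transfer-clamped collisional window LD along
  families (= item stmt-17691 `LocalClampedTransferLDAlongFamilies`, same term), (3) N-uniform Gaussian velocity moments along the true pre-shock
  evolution (= item stmt-14415 `UGibbsSRBRigidity.GaussianTails`, Nachtergaele–Yau Assumption II.1 guarded); `KineticWindowLDUniform`,
  `ClampedTransferWindowLD` and `DiluteSelfConsistency` are idle, `TransferActivityTails` and `EnergyCurrentTails` are consumed;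
* `hydrodynamicLimit_of_tailRateChildren : KCWUSharpPlus → LocalClampedTransferWindowLDFamily → UGibbsSRBRigidity.GaussianTails →
  TwoClocks.TransferActivityTails → TwoClocks.EnergyCurrentTails → _root_.HydrodynamicLimit` — the type a RESTATE of the crux would take.
The stub statements used by S_E / S_W′ are the verbatim copies in their own files; they are definitionally the ones of
`TwoClocksTransferEntropyClockTailRateDefs.lean`, so the landed theorems are used directly (eta-expanded) and typecheck by unfolding
(no restating wrappers — `dedup.landed`).
Lead prover-line-stmt-AtomisticToContinuum-16625-c5-0, cycle 3.
-/

noncomputable section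

namespace Summit.AtomisticToContinuum.HydrodynamicLimit.Theorems.TransferEntropyClockTailRate

open Summit.AtomisticToContinuum.HydrodynamicLimit.Theses
open Summit.AtomisticToContinuum.HydrodynamicLimit.Theorems
open Summit.AtomisticToContinuum.HydrodynamicLimit.Theorems.HydroLimitInBandOfHeart
  (GronwallCoreInBand LocalClampedTransferWindowLDFamily)

/-- **The 3-child split glue of crux 16625 (line tail-rate)**: the macroscopic clock BY NAME from the numeric kinetic rung, the local
transfer family node and the Gaussian velocity tails — `transferEntropyClock_of_tailRateChildren_of` (p143292) fed the two landed stubs.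
[cite: Yau1991, §2; NachtergaeleYau2003, §2.3 Assumption II.1] -/
theorem transferEntropyClock_of_tailRateChildren :
    KCWUSharpPlus → LocalClampedTransferWindowLDFamily → UGibbsSRBRigidity.GaussianTails → TwoClocks.TransferEntropyClock :=
  transferEntropyClock_of_tailRateChildren_of
    (fun h => TransferEntropyClockExplicitKineticFamily.stub_explicitKineticFamily h)
    (fun hKE => TransferEntropyClockTailRateWindowClause.stub_tailRateWindowClause hKE)

/-- **The restated clock of line tail-rate**: the sub-problem Statement from the three children and the crux's two true-law tail
antecedents alone (the guarded Grönwall core `gronwallCoreInBand_of_tailRateLedger`, then the landed in-band reductions).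
[cite: Yau1991, §2] -/
theorem hydrodynamicLimit_of_tailRateChildren :
    KCWUSharpPlus → LocalClampedTransferWindowLDFamily → UGibbsSRBRigidity.GaussianTails →
      TwoClocks.TransferActivityTails → TwoClocks.EnergyCurrentTails → _root_.HydrodynamicLimit :=
  fun hK hL hG h₇ h₆ =>
    TransferEntropyClockFamilyNodes.hydrodynamicLimit_iff_hydroLimitInBand.mpr
      (Theorems.hydroLimitInBand_of_relEntropyVanishingInBand
        (Theorems.EntropyClockDock.relEntropyVanishingInBand_of_gronwallCoreInBand
          (gronwallCoreInBand_of_tailRateLedger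
            (fun hKE => TransferEntropyClockTailRateWindowClause.stub_tailRateWindowClause hKE)
            (TransferEntropyClockExplicitKineticFamily.stub_explicitKineticFamily hK) hL hG h₇ h₆)))

end Summit.AtomisticToContinuum.HydrodynamicLimit.Theorems.TransferEntropyClockTailRate

end
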